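import Mathlib

/-!
# Exponential ledger glue (support for `ExponentiallyAffineResistance`, stmt-AtomisticToContinuum-12115)

Pure real analysis — the "FarContactDecoupling upgrades the series ledger" step foreseen (layer 2,
NOT DECOMPOSED YET paragraph) in route `PuiseuxTransferLedger`, proved here in the abstract so that
it is ready when the layer-2 statements are filed.

Setting. `ρ N i` (`i + 2 ≤ N`) are the local bond resistances of the `N`-chain (bond `(i, i+1)`,
`i = 0, …, N-2`), `r` the bulk resistivity, `0 ≤ θ < 1`.  Hypotheses:

* (TM, the `TwoModeBulk` inequality divided by the conductance) `|ρ N i - r| ≤ C (θ^i + θ^(N-2-i))`;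
* (FL, far-contact decoupling seen from the LEFT contact) `|ρ N i - ρ (N+1) i| ≤ C θ^(N-2-i)`;
* (FR, the same seen from the RIGHT contact) `|ρ N (N-2-j) - ρ (N+1) (N-1-j)| ≤ C θ^(N-2-j)`.

Conclusion (`exponentialLedgerGlue`): the ledger `Σ_{i<N-1} (ρ N i - r)` converges to a limit `ρ∞`
(the sum of the two contact resistances) at an exponential rate `C' θ'^N`, `θ' = √(max θ (1/4))`.
With the series ledger `R_N = 2/γ + Σ_{i<N-1} ρ N i` of the route's `closes` this is exactly the
by-product `|(N-1)/D_N - ((N-1) r + ρ)| ≤ C' θ'^N`, `ρ = 2/γ + ρ∞`.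

Proof: geometric increments make `N ↦ ρ N i` Cauchy with limit `a i`, `|ρ N i - a i| ≤ Cθ^(N-2-i)/(1-θ)`
and `|a i - r| ≤ C θ^i`; the one-sided estimate `leftLedger_estimate` bounds
`|Σ_{i<k} (ρ N i - r) - Σ_i (a i - r)| ≤ C/(1-θ)² (θ^(N-1-k) + θ^k)`; apply it to the chain and to
the reflected chain `j ↦ ρ N (N-2-j)` and split the bond sum in the middle.

The conditional assembly of the by-product in the route's vocabulary (the six hypotheses of
`closes` plus far-contact decoupling ⇒ `ExponentiallyAffineResistance`) is the companion file
`PuiseuxTransferLedgerExponentiallyAffineResistanceOfDecoupling.lean`.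
-/

namespace Summit.AtomisticToContinuum.FouriersLaw.Theorems

open Filter Topology Finset

/-- **One-sided exponential ledger estimate.** If `|f N i - r| ≤ C (θ^i + θ^(N-2-i))` and
`|f N i - f (N+1) i| ≤ C θ^(N-2-i)` for `i + 2 ≤ N` (`0 ≤ θ < 1`, `0 ≤ C`), then the limits
`a i = lim_N f N i` exist, `Σ_i (a i - r)` converges, and for `k + 1 ≤ N`
`|Σ_{i<k} (f N i - r) - Σ_i (a i - r)| ≤ C/(1-θ)² · (θ^(N-1-k) + θ^k)`. [folklore] -/
theorem leftLedger_estimate {f : ℕ → ℕ → ℝ} {r θ C : ℝ} (hθ0 : 0 ≤ θ) (hθ1 : θ < 1)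
    (hC : 0 ≤ C)
    (h1 : ∀ N i : ℕ, i + 2 ≤ N → |f N i - r| ≤ C * (θ ^ i + θ ^ (N - 2 - i)))
    (h2 : ∀ N i : ℕ, i + 2 ≤ N → |f N i - f (N + 1) i| ≤ C * θ ^ (N - 2 - i)) :
    ∃ a : ℝ, ∀ N k : ℕ, k + 1 ≤ N →
      |∑ i ∈ range k, (f N i - r) - a| ≤ C / (1 - θ) ^ 2 * (θ ^ (N - 1 - k) + θ ^ k) := by
  have h1θ : 0 < 1 - θ := sub_pos.mpr hθ1
  have h1θle : 1 - θ ≤ 1 := by linarith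
  -- shifted sequences `g i n := f (n + i + 2) i` have geometric increments
  set g : ℕ → ℕ → ℝ := fun i n => f (n + i + 2) i with hg
  have hg_step : ∀ i n, dist (g i n) (g i (n + 1)) ≤ C * θ ^ n := by
    intro i n
    have h := h2 (n + i + 2) i (by omega)
    have e1 : n + i + 2 - 2 - i = n := by omega
    have e2 : n + i + 2 + 1 = n + 1 + i + 2 := by omega
    rw [e1, e2] at h
    simpa [hg, Real.dist_eq] using h
  choose a ha using fun i =>
    cauchySeq_tendsto_of_complete (cauchySeq_of_le_geometric θ C hθ1 (hg_step i))
  -- `|f N i - a i| ≤ C θ^(N-2-i)/(1-θ)` for `N ≥ i + 2`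
  have hfa : ∀ N i, i + 2 ≤ N → |f N i - a i| ≤ C * θ ^ (N - 2 - i) / (1 - θ) := by
    intro N i hi
    have h := dist_le_of_le_geometric_of_tendsto θ C hθ1 (hg_step i) (ha i) (N - 2 - i)
    have e : N - 2 - i + i + 2 = N := by omega
    simpa [hg, Real.dist_eq, e] using h
  -- `|a i - r| ≤ C θ^i`
  have har : ∀ i, |a i - r| ≤ C * θ ^ i := by
    intro i
    have hlim1 : Tendsto (fun n => |g i n - r|) atTop (𝓝 (|a i - r|)) :=
      ((ha i).sub_const r).abs
    have hlim2 : Tendsto (fun n : ℕ => C * (θ ^ i + θ ^ n)) atTop (𝓝 (C * (θ ^ i + 0))) :=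
      ((tendsto_pow_atTop_nhds_zero_of_lt_one hθ0 hθ1).const_add (θ ^ i)).const_mul C
    rw [add_zero] at hlim2
    refine le_of_tendsto_of_tendsto' hlim1 hlim2 fun n => ?_
    have h := h1 (n + i + 2) i (by omega)
    have e1 : n + i + 2 - 2 - i = n := by omega
    rw [e1] at h
    simpa [hg] using h
  -- the series of limit deviations converges absolutely
  have hgeoC : Summable fun i : ℕ => C * θ ^ i := (summable_geometric_of_lt_one hθ0 hθ1).mul_left C
  have hsumm : Summable fun i => a i - r :=
    Summable.of_norm_bounded (g := fun i => C * θ ^ i) hgeoC fun i => by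
      simpa [Real.norm_eq_abs] using har i
  refine ⟨∑' i, (a i - r), fun N k hk => ?_⟩
  -- tail of the series beyond `k`
  have htail : |∑' i, (a (i + k) - r)| ≤ C * θ ^ k / (1 - θ) := by
    have hs' : Summable fun i => a (i + k) - r := (summable_nat_add_iff k).mpr hsumm
    have hgeo : Summable fun i : ℕ => C * θ ^ k * θ ^ i :=
      (summable_geometric_of_lt_one hθ0 hθ1).mul_left _
    calc |∑' i, (a (i + k) - r)| ≤ ∑' i, |a (i + k) - r| := by
            have h := norm_tsum_le_tsum_norm hs'.norm
            simpa only [Real.norm_eq_abs] using h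
      _ ≤ ∑' i : ℕ, C * θ ^ k * θ ^ i := by
            refine Summable.tsum_le_tsum (fun i => ?_) hs'.abs hgeo
            calc |a (i + k) - r| ≤ C * θ ^ (i + k) := har (i + k)
              _ = C * θ ^ k * θ ^ i := by rw [pow_add]; ring
      _ = C * θ ^ k * ∑' i : ℕ, θ ^ i := tsum_mul_left
      _ = C * θ ^ k / (1 - θ) := by
            rw [tsum_geometric_of_lt_one hθ0 hθ1, div_eq_mul_inv]
  -- head: the first `k` bonds against their limits
  have hgeom : ∑ j ∈ range k, θ ^ j ≤ 1 / (1 - θ) := by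
    rw [le_div_iff₀ h1θ, geom_sum_mul_neg]
    linarith [pow_nonneg hθ0 k]
  have hrefl : ∑ i ∈ range k, θ ^ (k - 1 - i) = ∑ j ∈ range k, θ ^ j :=
    Finset.sum_range_reflect (fun j => θ ^ j) k
  have hhead : |∑ i ∈ range k, (f N i - a i)| ≤ C / (1 - θ) ^ 2 * θ ^ (N - 1 - k) := by
    calc |∑ i ∈ range k, (f N i - a i)|
        ≤ ∑ i ∈ range k, |f N i - a i| := Finset.abs_sum_le_sum_abs _ _
      _ ≤ ∑ i ∈ range k, C / (1 - θ) * θ ^ (N - 1 - k) * θ ^ (k - 1 - i) := by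
          refine Finset.sum_le_sum fun i hi => ?_
          rw [Finset.mem_range] at hi
          have e : N - 2 - i = (N - 1 - k) + (k - 1 - i) := by omega
          calc |f N i - a i| ≤ C * θ ^ (N - 2 - i) / (1 - θ) := hfa N i (by omega)
            _ = C / (1 - θ) * θ ^ (N - 1 - k) * θ ^ (k - 1 - i) := by rw [e, pow_add]; ring
      _ = C / (1 - θ) * θ ^ (N - 1 - k) * ∑ j ∈ range k, θ ^ j := by
          rw [← Finset.mul_sum, hrefl]
      _ ≤ C / (1 - θ) * θ ^ (N - 1 - k) * (1 / (1 - θ)) :=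
          mul_le_mul_of_nonneg_left hgeom (by positivity)
      _ = C / (1 - θ) ^ 2 * θ ^ (N - 1 - k) := by
          field_simp
  -- assemble: split the series at `k`
  have hsplit : ∑ i ∈ range k, (f N i - r) - ∑' i, (a i - r) =
      ∑ i ∈ range k, (f N i - a i) - ∑' i, (a (i + k) - r) := by
    rw [← hsumm.sum_add_tsum_nat_add k, Finset.sum_sub_distrib, Finset.sum_sub_distrib,
      Finset.sum_sub_distrib]
    ring
  rw [hsplit]
  have hKmono : C * θ ^ k / (1 - θ) ≤ C / (1 - θ) ^ 2 * θ ^ k := by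
    rw [div_le_iff₀ h1θ]
    have : C / (1 - θ) ^ 2 * θ ^ k * (1 - θ) = C * θ ^ k / (1 - θ) := by
      field_simp
    rw [this, le_div_iff₀ h1θ]
    have hθk : 0 ≤ C * θ ^ k := mul_nonneg hC (pow_nonneg hθ0 k)
    nlinarith
  calc |∑ i ∈ range k, (f N i - a i) - ∑' i, (a (i + k) - r)|
      ≤ |∑ i ∈ range k, (f N i - a i)| + |∑' i, (a (i + k) - r)| := abs_sub _ _
    _ ≤ C / (1 - θ) ^ 2 * θ ^ (N - 1 - k) + C * θ ^ k / (1 - θ) := add_le_add hhead htail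
    _ ≤ C / (1 - θ) ^ 2 * θ ^ (N - 1 - k) + C / (1 - θ) ^ 2 * θ ^ k :=
        add_le_add le_rfl hKmono
    _ = C / (1 - θ) ^ 2 * (θ ^ (N - 1 - k) + θ ^ k) := by ring

/-- **Exponential ledger glue.** If the local bond resistances `ρ N i` of the `N`-chains
(`i + 2 ≤ N`) satisfy the two-mode inequality `|ρ N i - r| ≤ C (θ^i + θ^(N-2-i))` and the two
far-contact decoupling inequalities `|ρ N i - ρ (N+1) i| ≤ C θ^(N-2-i)` (left-aligned) and
`|ρ N (N-2-j) - ρ (N+1) (N-1-j)| ≤ C θ^(N-2-j)` (right-aligned), with `0 ≤ θ < 1`, then the series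
ledger is exponentially affine: there are `ρ∞`, `C'` and `θ' ∈ [0, 1)` with
`|Σ_{i<N-1} (ρ N i - r) - ρ∞| ≤ C' θ'^N` for all `N ≥ 2` (in fact `θ' = √(max θ (1/4))`).
[folklore] -/
theorem exponentialLedgerGlue {ρ : ℕ → ℕ → ℝ} {r θ C : ℝ} (hθ0 : 0 ≤ θ) (hθ1 : θ < 1)
    (hTM : ∀ N i : ℕ, i + 2 ≤ N → |ρ N i - r| ≤ C * (θ ^ i + θ ^ (N - 2 - i)))
    (hL : ∀ N i : ℕ, i + 2 ≤ N → |ρ N i - ρ (N + 1) i| ≤ C * θ ^ (N - 2 - i))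
    (hR : ∀ N j : ℕ, j + 2 ≤ N →
      |ρ N (N - 2 - j) - ρ (N + 1) (N - 1 - j)| ≤ C * θ ^ (N - 2 - j)) :
    ∃ ρ' C' θ' : ℝ, 0 ≤ θ' ∧ θ' < 1 ∧
      ∀ N : ℕ, 2 ≤ N → |∑ i ∈ range (N - 1), (ρ N i - r) - ρ'| ≤ C' * θ' ^ N := by
  -- `C ≥ 0` (the hypothesis at `N = 2`, `i = 0`)
  have hC : 0 ≤ C := by
    have h := hTM 2 0 le_rfl
    norm_num at h
    linarith [abs_nonneg (ρ 2 0 - r)]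
  -- enlarge `θ` to `θ₁ := max θ (1/4) > 0`
  set θ₁ : ℝ := max θ (1 / 4) with hθ₁
  have hθ₁0 : 0 < θ₁ := lt_max_of_lt_right (by norm_num)
  have hθ₁1 : θ₁ < 1 := max_lt hθ1 (by norm_num)
  have hpow : ∀ n : ℕ, θ ^ n ≤ θ₁ ^ n := fun n => pow_le_pow_left₀ hθ0 (le_max_left _ _) n
  have hTM₁ : ∀ N i : ℕ, i + 2 ≤ N → |ρ N i - r| ≤ C * (θ₁ ^ i + θ₁ ^ (N - 2 - i)) :=
    fun N i h => (hTM N i h).trans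
      (mul_le_mul_of_nonneg_left (add_le_add (hpow _) (hpow _)) hC)
  have hL₁ : ∀ N i : ℕ, i + 2 ≤ N → |ρ N i - ρ (N + 1) i| ≤ C * θ₁ ^ (N - 2 - i) :=
    fun N i h => (hL N i h).trans (mul_le_mul_of_nonneg_left (hpow _) hC)
  have hR₁ : ∀ N j : ℕ, j + 2 ≤ N →
      |ρ N (N - 2 - j) - ρ (N + 1) (N - 1 - j)| ≤ C * θ₁ ^ (N - 2 - j) :=
    fun N j h => (hR N j h).trans (mul_le_mul_of_nonneg_left (hpow _) hC)
  -- the reflected chain `σ N j := ρ N (N - 2 - j)` satisfies the same two-mode inequality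
  have hTMσ : ∀ N j : ℕ, j + 2 ≤ N →
      |ρ N (N - 2 - j) - r| ≤ C * (θ₁ ^ j + θ₁ ^ (N - 2 - j)) := by
    intro N j hj
    have h := hTM₁ N (N - 2 - j) (by omega)
    have e : N - 2 - (N - 2 - j) = j := by omega
    rw [e, add_comm] at h
    exact h
  obtain ⟨a, ha⟩ := leftLedger_estimate hθ₁0.le hθ₁1 hC hTM₁ hL₁
  obtain ⟨b, hb⟩ := leftLedger_estimate (f := fun N j => ρ N (N - 2 - j)) hθ₁0.le hθ₁1 hC hTMσ hR₁
  set K : ℝ := C / (1 - θ₁) ^ 2 with hK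
  have hK0 : 0 ≤ K := by positivity
  set θ' : ℝ := Real.sqrt θ₁ with hθ'
  have hθ'0 : 0 ≤ θ' := Real.sqrt_nonneg _
  have hθ'1 : θ' < 1 := by
    rw [hθ', Real.sqrt_lt' one_pos]
    simpa using hθ₁1
  have hθ'sq : θ' ^ 2 = θ₁ := Real.sq_sqrt hθ₁0.le
  refine ⟨a + b, 4 * K / θ₁, θ', hθ'0, hθ'1, fun N hN => ?_⟩
  -- split the `N - 1` bonds into the `kL` leftmost and the `kR` rightmost ones
  obtain ⟨n, hn⟩ : ∃ n : ℕ, N = n + 1 := ⟨N - 1, by omega⟩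
  have hNn : N - 1 = n := by omega
  set kL : ℕ := n / 2 with hkL
  set kR : ℕ := n - kL with hkR
  have hsum : kL + kR = n := by omega
  have hrefl : ∑ j ∈ range kR, (ρ N (N - 2 - j) - r) = ∑ x ∈ range kR, (ρ N (kL + x) - r) := by
    rw [← Finset.sum_range_reflect (fun x => ρ N (kL + x) - r) kR]
    refine Finset.sum_congr rfl fun j hj => ?_
    rw [Finset.mem_range] at hj
    have e : N - 2 - j = kL + (kR - 1 - j) := by omega
    simp only [e]
  have hsplit : ∑ i ∈ range (N - 1), (ρ N i - r) =
      ∑ i ∈ range kL, (ρ N i - r) + ∑ j ∈ range kR, (ρ N (N - 2 - j) - r) := by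
    rw [hNn, ← hsum, Finset.sum_range_add, hrefl]
  have hA := ha N kL (by omega)
  have hB := hb N kR (by omega)
  -- every exponent is at least `kL`
  have hmono : ∀ e : ℕ, kL ≤ e → θ₁ ^ e ≤ θ₁ ^ kL :=
    fun e he => pow_le_pow_of_le_one hθ₁0.le hθ₁1.le he
  have h4 : K * (θ₁ ^ (N - 1 - kL) + θ₁ ^ kL) + K * (θ₁ ^ (N - 1 - kR) + θ₁ ^ kR) ≤
      4 * K * θ₁ ^ kL := by
    have e1 := hmono (N - 1 - kL) (by omega)
    have e2 := hmono (N - 1 - kR) (by omega)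
    have e3 := hmono kR (by omega)
    nlinarith
  -- `θ₁ ^ kL * θ₁ ≤ θ' ^ N` since `2 (kL + 1) ≥ N`
  have hkey : θ₁ ^ kL * θ₁ ≤ θ' ^ N := by
    calc θ₁ ^ kL * θ₁ = θ₁ ^ (kL + 1) := (pow_succ θ₁ kL).symm
      _ = θ' ^ (2 * (kL + 1)) := by rw [pow_mul, hθ'sq]
      _ ≤ θ' ^ N := pow_le_pow_of_le_one hθ'0 hθ'1.le (by omega)
  have heq : ∑ i ∈ range (N - 1), (ρ N i - r) - (a + b) =
      (∑ i ∈ range kL, (ρ N i - r) - a) + (∑ j ∈ range kR, (ρ N (N - 2 - j) - r) - b) := by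
    rw [hsplit]; ring
  calc |∑ i ∈ range (N - 1), (ρ N i - r) - (a + b)|
      = |(∑ i ∈ range kL, (ρ N i - r) - a) + (∑ j ∈ range kR, (ρ N (N - 2 - j) - r) - b)| := by
        rw [heq]
    _ ≤ |∑ i ∈ range kL, (ρ N i - r) - a| + |∑ j ∈ range kR, (ρ N (N - 2 - j) - r) - b| :=
        abs_add_le _ _
    _ ≤ K * (θ₁ ^ (N - 1 - kL) + θ₁ ^ kL) + K * (θ₁ ^ (N - 1 - kR) + θ₁ ^ kR) := add_le_add hA hB
    _ ≤ 4 * K * θ₁ ^ kL := h4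
    _ = 4 * K / θ₁ * (θ₁ ^ kL * θ₁) := by
        field_simp
    _ ≤ 4 * K / θ₁ * θ' ^ N := mul_le_mul_of_nonneg_left hkey (by positivity)

end Summit.AtomisticToContinuum.FouriersLaw.Theorems
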